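import Summits.CriticalPhenomena.PercolationContinuityZ3.Theorems.Transplant.SkelNegBParamsSlotsS
import HarnessLib

/-!
# N1 params, chain of record `NegB`, part SlotsST: THE FIBRE-BLOCK SLOT VALUE OF RECORD WITH FUNCTION-VALUED RESIDUAL SLOTS `NegB.ST (ex mx : NegB.GSlot) : NegB.SSlot` (supersedes part SlotsS's `SR`, whose `ex mx : ℕ` were constants and cannot carry the p-fixed floors `ex ≥ KS.r₀A … Rl`, `≥ RlevA + reachA`, (C)'s `E₀Z`, (F)'s `hdiam`) (the q-level `SchedIn` the schedule of record
# `schedOf … (SR …)` reads) — `rmax := max fcells.rmax (cOff + 1)` (hp-8 g33 2026-08-21T15:4xZ: `hgap20/hgapc/hgapR`), `u := 1`, `M := ψM := ψtop := 0`, `reachK := ex` (a RESIDUAL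
# floor slot for `L′`/`E₀`: any lower bound a residue posts later is a value of `ex`, not a file), `Rex := NegB.Rex (mR … mx) q` (part Excess: the monotone hull of the excess
# radius at planar diameter `mR := max (80·(n_L+ℓ_L+3|h_L|+1)·(50·fcells.rmax+1)) mx`), and every schedule-side binder of the three residues BY NAME

builds on p205010 (kernel theorem, internal audit signed; external expert review pending) — nothing in this file uses p205010; NOTHING is claimed about
the node `SamePDropOfSkeletonNeg₁` (OPEN).
Status sentence (coordinator 2026-08-20T04:30Z): "θ(p_c) = 0 on ℤ^d, all d ≥ 2 — kernel-verified (Lean 4/Mathlib, standard axioms); internal adversarial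
audit SIGNED 2026-08-20 04:29Z; external expert review pending."
Lane `prim-bschramm-*`, seat `prim-bschramm-stmt` (gen 14); helper file (`--supports stmt-CriticalPhenomena-4575 --as helper`); ledger HOME/prim-bschramm-stmt/NEG-PARAMS.md v0.12.
Reading: `Λ := schedOf κ Φ t p D g f (ST ex mx κ Φ t p D g f q) = Prm.schedN (ST …) fcells offN = concRadii2N fcells (Prm.gap S) 0 (Prm.E₀ S) (Prm.Lp S) offN` (`Prm.schedN_eq`).
* §1 `GSlot`, `GSlot.zero`, **`ST`**, `ST_fields` (rfl), `ST_rmax_ge`;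
* §2 at `S := ST …`: **`hgap20_T`**, **`hgapc_T`**, **`hgapR_T`**, `hgapL_T`, `ex_le_Lp_T`, `three_le_E₀_T`, `hsch_T`, `Rex_mono_T`;
* §3 **`hR₁_T`/`hRex_T`** (consumer instance), `hR₁_T_η` (the box hypothesis at `mR … (mx …)` is served by part SlotsS's `fine_diam_le_mR` verbatim).
[cite: KozmaNitzan2024, §4 Theorem 6 (pp. 25–31); Lemma 12 (p. 24)] [cite: MartineauTassion2017, §4.3]
-/

noncomputable section

open scoped Classical

namespace Summit.CriticalPhenomena.PercolationContinuityZ3.Theorems.Transplant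

namespace PlanarSkeletonNeg

namespace NegB

open MeasureTheory Literature.Probability.Percolation Literature.Probability.LatticeModels SimpleGraph
open Literature.Barriers.CriticalPhenomena (graphBall)
open SkelConc (Consts)
open BoxProdZ2 (ConcRadiiG Erad)
open Skelφ (oriφ trφ)
open Skelφ.StepI (DataN OutO)
open Skel (excess)
open Neg

/-! ## §1 The residual function slot and the fibre block of record -/

/-- **A (g,f)-level residual slot**: a floor as a function of everything p-fixed AND the box/width values `(g, f)`. [this work] -/
def GSlot : Type 1 :=
  ∀ (κ : Consts) {V : Type} [DecidableEq V] [Countable V] {G : SimpleGraph V} [G.LocallyFinite], PlanarSkeletonNeg G → V → unitInterval → DataN V → ℕ → ℕ → ℕ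

/-- The zero residual. [folklore] -/
def GSlot.zero : GSlot := fun _ _ _ _ _ _ _ _ _ _ _ _ => 0

/-- **THE FIBRE BLOCK OF RECORD** (residual FUNCTION slots `ex` for `L′/E₀`, `mx` for the excess diameter):
`⟨max fcells.rmax (cOff+1), 1, 0, 0, 0, ex κ Φ t p D g f, NegB.Rex (mR … (mx κ Φ t p D g f)) q⟩`. [cite: KozmaNitzan2024, §4 Theorem 6 (pp. 25–31): the order of constants] -/
def ST (ex mx : GSlot) : SSlot := fun κ _ _ _ _ _ Φ t p D g f q =>
  ⟨max (fcells κ Φ t p D g f).rmax (cOff κ Φ t p D g f + 1), 1, 0, 0, 0, ex κ Φ t p D g f, Rex κ Φ (mR κ Φ t p D g f (mx κ Φ t p D g f)) q⟩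

section Facts

variable (κ : Consts) {V : Type} [DecidableEq V] [Countable V] {G : SimpleGraph V} [G.LocallyFinite] (Φ : PlanarSkeletonNeg G) (t : V)
  (p : unitInterval) (D : DataN V) (g f : ℕ) (ex mx : GSlot) (q : unitInterval)

/-- The fields of `SR` (all `rfl`). [folklore] -/
theorem ST_fields : (ST ex mx κ Φ t p D g f q).rmax = max (fcells κ Φ t p D g f).rmax (cOff κ Φ t p D g f + 1) ∧ (ST ex mx κ Φ t p D g f q).u = 1 ∧
    (ST ex mx κ Φ t p D g f q).M = 0 ∧ (ST ex mx κ Φ t p D g f q).ψM = 0 ∧ (ST ex mx κ Φ t p D g f q).ψtop = 0 ∧ (ST ex mx κ Φ t p D g f q).reachK = ex κ Φ t p D g f ∧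
    (ST ex mx κ Φ t p D g f q).Rex = Rex κ Φ (mR κ Φ t p D g f (mx κ Φ t p D g f)) q :=
  ⟨rfl, rfl, rfl, rfl, rfl, rfl, rfl⟩

/-- `fcells.rmax ≤ rmax` and `cOff + 1 ≤ rmax`. [folklore] -/
theorem ST_rmax_ge : (fcells κ Φ t p D g f).rmax ≤ (ST ex mx κ Φ t p D g f q).rmax ∧ cOff κ Φ t p D g f + 1 ≤ (ST ex mx κ Φ t p D g f q).rmax :=
  ⟨le_max_left _ _, le_max_right _ _⟩

/-! ## §2 The gap, `L′`, `E₀` at the value -/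

/-- **`20·fcells.rmax ≤ gap ρ`** ((C)'s `hgap`, hp-8's `hgap20`). [folklore] -/
theorem hgap20_T (ρ : ℕ) : 20 * (fcells κ Φ t p D g f).rmax ≤ Skelφ.Prm.gap (ST ex mx κ Φ t p D g f q) ρ :=
  le_trans (Nat.mul_le_mul_left _ (ST_rmax_ge κ Φ t p D g f ex mx q).1) (Skelφ.Prm.twenty_rmax_le_gap _ ρ)

/-- **`cOff ≤ gap ρ`** ((C)'s `hgapc`/`hgapC` with `c := cOff`, hp-8's `hgapc`). [folklore] -/
theorem hgapc_T (ρ : ℕ) : cOff κ Φ t p D g f ≤ Skelφ.Prm.gap (ST ex mx κ Φ t p D g f q) ρ := by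
  have h1 := (ST_rmax_ge κ Φ t p D g f ex mx q).2
  have h2 := Skelφ.Prm.dG_le_gap (ST ex mx κ Φ t p D g f q) ρ
  exact le_trans (le_trans (le_trans (Nat.le_succ _) h1) (Nat.le_mul_of_pos_left _ (by norm_num))) h2

/-- **`cOff + 2L′ + Rex ρ + 2 ≤ gap ρ`** (hp-8's `hgapR` with `R₁ := Rex`; `gap ρ = 2L′ + 1 + Rex (ρ+1) + 100·rmax`, `Rex` monotone, `100·rmax ≥ 100(cOff+1)`). [folklore] -/
theorem hgapR_T (ρ : ℕ) : cOff κ Φ t p D g f + 2 * Skelφ.Prm.Lp (ST ex mx κ Φ t p D g f q) + Rex κ Φ (mR κ Φ t p D g f (mx κ Φ t p D g f)) q ρ + 2 ≤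
    Skelφ.Prm.gap (ST ex mx κ Φ t p D g f q) ρ := by
  rw [Skelφ.Prm.gap_eq]
  have h1 : cOff κ Φ t p D g f + 1 ≤ (ST ex mx κ Φ t p D g f q).rmax := (ST_rmax_ge κ Φ t p D g f ex mx q).2
  have h2 : Rex κ Φ (mR κ Φ t p D g f (mx κ Φ t p D g f)) q ρ ≤ (ST ex mx κ Φ t p D g f q).Rex (ρ + 1) := Rex_mono κ Φ _ q (Nat.le_succ ρ)
  generalize (ST ex mx κ Φ t p D g f q).rmax = R at h1 ⊢
  generalize (ST ex mx κ Φ t p D g f q).Rex (ρ + 1) = X at h2 ⊢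
  generalize Skelφ.Prm.Lp (ST ex mx κ Φ t p D g f q) = L
  omega

/-- `L′ ≤ gap ρ`. [folklore] -/
theorem hgapL_T (ρ : ℕ) : Skelφ.Prm.Lp (ST ex mx κ Φ t p D g f q) ≤ Skelφ.Prm.gap (ST ex mx κ Φ t p D g f q) ρ := Skelφ.Prm.hgapL _ ρ

/-- **The residual floor reaches `L′` and `E₀`**: `ex ≤ L′ ≤ E₀`. [folklore] -/
theorem ex_le_Lp_T : ex κ Φ t p D g f ≤ Skelφ.Prm.Lp (ST ex mx κ Φ t p D g f q) ∧ Skelφ.Prm.Lp (ST ex mx κ Φ t p D g f q) ≤ Skelφ.Prm.E₀ (ST ex mx κ Φ t p D g f q) := by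
  refine ⟨?_, Skelφ.Prm.Lp_le_E₀ _⟩
  have h := Skelφ.Prm.reachK_le_Lp (ST ex mx κ Φ t p D g f q)
  exact h

/-- `3 ≤ E₀` ((C)'s `hE₀`), indeed `45·rmax ≤ E₀` with `rmax ≥ 1`. [folklore] -/
theorem three_le_E₀_T : 3 ≤ Skelφ.Prm.E₀ (ST ex mx κ Φ t p D g f q) ∧ 45 * (fcells κ Φ t p D g f).rmax ≤ Skelφ.Prm.E₀ (ST ex mx κ Φ t p D g f q) := by
  have h1 := Skelφ.Prm.planar_le_E₀ (ST ex mx κ Φ t p D g f q)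
  have h2 := (ST_rmax_ge κ Φ t p D g f ex mx q).1
  have h3 : 1 ≤ (fcells κ Φ t p D g f).rmax := le_trans ((fcells κ Φ t p D g f).one_le_r 0) ((fcells κ Φ t p D g f).r_le_rmax 0)
  have h4 : 45 * (fcells κ Φ t p D g f).rmax ≤ Skelφ.Prm.E₀ (ST ex mx κ Φ t p D g f q) :=
    le_trans (le_trans (Nat.mul_le_mul_left 45 h2) (Nat.le_add_right _ _)) h1
  exact ⟨le_trans (le_trans (by norm_num : 3 ≤ 45 * 1) (Nat.mul_le_mul_left 45 h3)) h4, h4⟩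

/-- **`hsch`**: `Rex (E g' + 1) + L′ ≤ E (g'+1)` for `E := Erad gap 0 E₀` (D″'s `Prm.hsch`, `100·rmax` absorbed). [folklore] -/
theorem hsch_T (g' : ℕ) : Rex κ Φ (mR κ Φ t p D g f (mx κ Φ t p D g f)) q (Erad (Skelφ.Prm.gap (ST ex mx κ Φ t p D g f q)) (fun _ => 0) (Skelφ.Prm.E₀ (ST ex mx κ Φ t p D g f q)) g' + 1) +
      Skelφ.Prm.Lp (ST ex mx κ Φ t p D g f q) ≤ Erad (Skelφ.Prm.gap (ST ex mx κ Φ t p D g f q)) (fun _ => 0) (Skelφ.Prm.E₀ (ST ex mx κ Φ t p D g f q)) (g' + 1) := by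
  have h := Skelφ.Prm.hsch (ST ex mx κ Φ t p D g f q) g'
  exact le_trans (Nat.add_le_add_right (Nat.le_add_right _ _) _) h

/-- `Rex` at the value is monotone ((C)'s excess radius as a function of the entrance depth). [folklore] -/
theorem Rex_mono_T : Monotone (ST ex mx κ Φ t p D g f q).Rex := Rex_monotone κ Φ _ q

/-! ## §3 The excess at the value -/

/-- **`hR₁` at the value** ((F)/(R): depth `ρ+1`, any centre, either orientation, any `η' ≥ η`, planar diameter `mR`) — stated with the consumer's `[DecidableEq V]`
instance inside `Neg.η` (part Excess's `hR₁_at` carries the classical one; the two agree by `Subsingleton.elim`, which `convert` discharges). [folklore] -/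
theorem hR₁_T (hC : Φ.CylSubcritical q) (o : Bool) {η' : ℝ} (hη' : Neg.η κ Φ ≤ η') (c : V) :
    ∀ ρ R', (ST ex mx κ Φ t p D g f q).Rex ρ ≤ R' → ∀ (Rw : ℕ) (D' A' : Finset V), (∀ d ∈ D', d ∈ graphBall G c Rw) →
      (∀ d ∈ D', ∀ d' ∈ D', oriφ Φ.φ o d - oriφ Φ.φ o d' ∈ box 2 (mR κ Φ t p D g f (mx κ Φ t p D g f))) → A' ⊆ D' → (∀ a ∈ A', a ∈ graphBall G c (ρ + 1)) →
        (bondPercolation G q).real (excess G c R' D' A') ≤ η' := by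
  have hη'' : @Neg.η κ V (fun a b => Classical.propDecidable (a = b)) _ G _ Φ ≤ η' := by convert hη' using 2
  exact hR₁_at κ Φ (mR κ Φ t p D g f (mx κ Φ t p D g f)) hC o hη'' c

/-- **`hRex` at the value** ((C): depth `R₀'`), consumer's instance. [folklore] -/
theorem hRex_T (hC : Φ.CylSubcritical q) (o : Bool) {η' : ℝ} (hη' : Neg.η κ Φ ≤ η') (c : V) :
    ∀ R₀' R₁, (ST ex mx κ Φ t p D g f q).Rex R₀' ≤ R₁ → ∀ (Rw : ℕ) (D' A' : Finset V), (∀ d ∈ D', d ∈ graphBall G c Rw) →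
      (∀ d ∈ D', ∀ d' ∈ D', oriφ Φ.φ o d - oriφ Φ.φ o d' ∈ box 2 (mR κ Φ t p D g f (mx κ Φ t p D g f))) → A' ⊆ D' → (∀ a ∈ A', a ∈ graphBall G c R₀') →
        (bondPercolation G q).real (excess G c R₁ D' A') ≤ η' := by
  have hη'' : @Neg.η κ V (fun a b => Classical.propDecidable (a = b)) _ G _ Φ ≤ η' := by convert hη' using 2
  exact hRex_at κ Φ (mR κ Φ t p D g f (mx κ Φ t p D g f)) hC o hη'' c

/-- `η ≤ η` across instances: the consumer's `Neg.η`/`Neg.δkit` facts (`η_pos`, `δkit_le_δ`, …) feed `hR₁_R/hRex_R` directly; this records `η ≤ δkit/2`-type uses. [folklore] -/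
theorem hR₁_T_η (hC : Φ.CylSubcritical q) (o : Bool) (c : V) :
    ∀ ρ R', (ST ex mx κ Φ t p D g f q).Rex ρ ≤ R' → ∀ (Rw : ℕ) (D' A' : Finset V), (∀ d ∈ D', d ∈ graphBall G c Rw) →
      (∀ d ∈ D', ∀ d' ∈ D', oriφ Φ.φ o d - oriφ Φ.φ o d' ∈ box 2 (mR κ Φ t p D g f (mx κ Φ t p D g f))) → A' ⊆ D' → (∀ a ∈ A', a ∈ graphBall G c (ρ + 1)) →
        (bondPercolation G q).real (excess G c R' D' A') ≤ Neg.η κ Φ :=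
  hR₁_T κ Φ t p D g f ex mx q hC o le_rfl c

end Facts

end NegB

end PlanarSkeletonNeg

end Summit.CriticalPhenomena.PercolationContinuityZ3.Theorems.Transplant

end
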